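import Literature.AlgebraicGeometry.HodgeTheory.WeilClassesDescendingOfLefschetzOneOne
import Literature.AlgebraicGeometry.HodgeTheory.LefschetzOneOneSingleVariety
import Literature.AlgebraicGeometry.HodgeTheory.LefschetzOneOneOfGAGA
import Literature.AlgebraicGeometry.HodgeTheory.LefschetzOneOneOfKodairaSerre
import HarnessLib

/-!
# Schoen's transfer from the SURFACE-ONLY analytic input: Serre's Théorème A for line cocycles on surfaces

Family `hodge`, layer `Literature/AlgebraicGeometry/HodgeTheory`. Third sibling PROOF file of
`WeilClassesDescending` for the named fact `Schoen1998_weilClasses_algebraic_of_prod_surface_all`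
(C. Schoen, *Addendum to: Hodge classes on self-products of a variety with an automorphism*,
Compositio Math. 114 (1998) 329–336, §10 Proposition and its proof, pp. 332–333; E. Markman,
arXiv:2509.23403 §11.5 Step 2; K. Koike, Canad. Math. Bull. 47 (2004), Rem. 2.1). Everything here is
PROVED; no definition and no named fact is introduced. STATUS (2026-08-16): the fact is DISCHARGED —
`Schoen1998_weilClasses_algebraic_of_prod_surface_all_holds`, file `WeilClassesDescendingTransfer` — since
the re-cut under which its Weil-type witness carries Schoen's descent partner `t`. This file, like
`WeilClassesDescendingOfLefschetzOneOne`, is the road that IGNORES the partner (a witness given without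
`t`, as for an abstract Weil-type surface), now from SURFACE-LOCAL analytic inputs.

`WeilClassesDescendingOfLefschetzOneOne` reduced that road to Lefschetz's theorem on `(1,1)`-classes
(`…_of_lefschetzOneOne`), used there only on the partner SURFACE `A₂` (Schoen, p. 333: "`W_{A'}` is
generated by cohomology classes of divisors"). With the variety-by-variety form of the tree's
Lefschetz `(1,1)` reductions (`LefschetzOneOneSingleVariety`) the input shrinks accordingly:

* `lefschetzOneOne_surface_of_serre_theoremA` — Lefschetz `(1,1)` for every smooth projective SURFACE
  from the surface-only named fact `serre_theoremA_lineCocycle_surface` (`SerreTheoremALineBundles`),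
  variety by variety (`mem_algebraicClasses_one_of_exists_section_algebraicTwist_hodgeModels`);
  the surface fact IS the `n = 2` slice of the all-dimensional named fact
  `kodairaSerre_exists_globalSection_algebraicTwist` (`KodairaSerreSections`) —
  `serre_theoremA_lineCocycle_surface_of_kodairaSerre`, file `LefschetzOneOneOfKodairaSerre`, reused;
* `…_of_lefschetzOneOne_surface` — the fact from Lefschetz `(1,1)` for smooth projective SURFACES only;
* `…_of_exists_section_algebraicTwist_weilSurfaces` — the fact from the Kodaira–Serre sections of an
  algebraic twist of every holomorphic line cocycle on the Hodge models of the WEIL-TYPE ABELIAN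
  SURFACES `(A₂, φ₂)` only (Voisin I, proof of Cor. 11.34; on a complex torus: theta functions);
* `…_of_serre_theoremA_surface` — **the fact from the surface-only named fact
  `serre_theoremA_lineCocycle_surface`** (`SerreTheoremALineBundles`; Serre, GAGA n° 16 Théorème A for
  the sheaf of sections of a holomorphic line cocycle on a smooth projective surface) — the weakest
  named statement of the tree from which the partner-free road closes;
* `…_of_kodairaSerre`, `…_of_serreGAGA` — the fact from either all-dimensional named residual of
  `lefschetzOneOne_rational` (`kodairaSerre_exists_globalSection_algebraicTwist`, `KodairaSerreSections`;
  `serreGAGA_lineCocycle_iso_cartierDivisorCocycle`, `GAGALineBundles`).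

Why an analytic input at all (recorded in the unit's census): every class on `A₂` constructible on
the carriers from the data of the fact — hyperplane classes of `A₁`, `A₂`, `A₁ × A₂`, the
endomorphisms `ℤ[φᵢ]`, the group law, the algebraic Weil classes of the product granted by the
hypothesis, under cup and Pontryagin products, pull-backs and Gysin maps — is homogeneous for the
bigrading of `H•(Aᵢ(ℂ); ℂ) = ⋀•(V₊ ⊕ V₋)` by `(⋀ᵖV₊) ∧ (⋀^qV₋)`, a `K`-compatible polarization having
bidegree `(1,1)` and traces killing all bidegrees but `(g,g)`; a partner divisor class on `A₂` must
have non-zero components of bidegrees `(2,0)` and `(0,2)` (`E± ⌣ E± = 0`, `E± ⌣ (V₊ ∧ V₋) = 0`), which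
for a `K`-compatible hyperplane class no such expression produces. The divisor exists
(`ρ(A₂) ≥ 2`), but only an existence theorem for divisors — Lefschetz `(1,1)` on `A₂`, i.e. sections
of line bundles (Kodaira–Serre, GAGA, or theta functions) — names it.

## References

* [Schoen1998HodgeWeilAddendum] C. Schoen, Compositio Math. 114 (1998) 329–336, §10 (Proposition and
  proof, pp. 332–333).
* [Markman2025SurveySecant] E. Markman, arXiv:2509.23403, §11.5 Step 2.
* [Koike2004WeilHodge] K. Koike, Canad. Math. Bull. 47 (2004), Remark 2.1.
* [VoisinHodgeI2002] C. Voisin, Hodge Theory and Complex Algebraic Geometry I (2002), Thm. 11.30,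
  Cor. 11.34 (proof), §11.3.2.
* [SerreGAGA1956] J.-P. Serre, GAGA, Ann. Inst. Fourier 6 (1956), n° 16–17, n° 20 Prop. 18.
-/

noncomputable section

open CategoryTheory
open scoped Manifold
open Literature.Geometry.Kaehler (HolomorphicLineBundle)
open Literature.AlgebraicGeometry Literature.AlgebraicGeometry.Motives
open Literature.AlgebraicTopology.SingularHomology

namespace Literature.AlgebraicGeometry.HodgeTheory

/-! ### The surface-only section fact, bridged to Lefschetz `(1,1)` for surfaces -/

/-- **Lefschetz's theorem on `(1,1)`-classes for every smooth projective SURFACE, from the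
surface-only named fact `serre_theoremA_lineCocycle_surface`** (Serre, GAGA n° 16 Théorème A for the
sheaf of sections of a holomorphic line cocycle on a smooth projective surface, sections form:
`SerreTheoremALineBundles`): for `X/ℂ` smooth projective of dimension `2`, every rational class
`c ∈ H²(X(ℂ); ℂ)` of Hodge type `(1,1)` lies in `algebraicClasses X 1`
(`mem_algebraicClasses_one_of_exists_section_algebraicTwist_hodgeModels`, file `LefschetzOneOneSingleVariety`).
[cite: VoisinHodgeI2002, Thm. 11.30, Cor. 11.34 and §11.3.2] [cite: SerreGAGA1956, n° 16–17 Théorèmes A–B] -/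
theorem lefschetzOneOne_surface_of_serre_theoremA (hA : serre_theoremA_lineCocycle_surface)
    ⦃X : Motives.SchemeOver ℂ⦄ (hX : Motives.IsSmoothProjective 2 X) (c : complexBetti X (2 * 1))
    (hc : IsRationalClass c) (h11 : IsOfHodgeType 2 X (2 * 1) 1 1 c) : c ∈ algebraicClasses X 1 :=
  mem_algebraicClasses_one_of_exists_section_algebraicTwist_hodgeModels hX (hA hX) c hc h11

/-! ### Schoen's transfer from the surface-local inputs -/

/-- **`Schoen1998_weilClasses_algebraic_of_prod_surface_all` from Lefschetz `(1,1)` for smooth projective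
SURFACES only**: the rational `(1,1)` Weil class `u₊ + u₋` of the partner surface `A₂` is algebraic by
the surface case of Lefschetz `(1,1)`, and
`Schoen1998_weilClasses_algebraic_of_prod_surface_all_of_surfaceWeilClasses_algebraic` (the transfer,
proved on the carriers with `t = u` as its own partner divisor class) concludes.
[cite: Schoen1998HodgeWeilAddendum, §10 (Proposition and proof, pp. 332–333)]
[cite: VoisinHodgeI2002, Thm. 11.30 and §11.3.2] -/
theorem Schoen1998_weilClasses_algebraic_of_prod_surface_all_of_lefschetzOneOne_surface
    (hL : ∀ ⦃X : Motives.SchemeOver ℂ⦄, Motives.IsSmoothProjective 2 X →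
      ∀ c : complexBetti X (2 * 1), IsRationalClass c → IsOfHodgeType 2 X (2 * 1) 1 1 c →
        c ∈ algebraicClasses X 1) :
    Schoen1998_weilClasses_algebraic_of_prod_surface_all :=
  Schoen1998_weilClasses_algebraic_of_prod_surface_all_of_surfaceWeilClasses_algebraic
    fun _ _ _ _ _ hA _ up um _ _ hr hw => hL hA (up + um) hr hw

/-- **`Schoen1998_weilClasses_algebraic_of_prod_surface_all` from the Kodaira–Serre sections on the
Hodge models of the WEIL-TYPE ABELIAN SURFACES only** (Voisin I, proof of Cor. 11.34, with the ample
power `H^{⊗N}` spelled as an algebraic twist `𝒪_{A₂}(D)^an` carrying a non-zero algebraic section `s`):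
if for every complex abelian surface `(A₂, φ₂)`, `φ₂ ≫ φ₂ = -(d • 𝟙 A₂)`, `d ≥ 1`, smooth projective of
dimension `2`, every Hodge model `A` of `A₂` and every holomorphic line cocycle `L` on `A.carrier`
there are a Cartier divisor `D` on `A₂`, a non-zero `s ∈ Γ(A₂, 𝒪(D))` and a global holomorphic
section of `L ⊗ 𝒪(D)^an` which is not identically zero (on the complex torus `A₂(ℂ)`: the classical
theta functions), then the fact holds — Lefschetz `(1,1)` for `A₂`
(`mem_algebraicClasses_one_of_exists_section_algebraicTwist_hodgeModels`) makes its Weil class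
algebraic. [cite: Schoen1998HodgeWeilAddendum, §10 (Proposition and proof, pp. 332–333)]
[cite: VoisinHodgeI2002, Cor. 11.34 (proof) and Thm. 11.30] -/
theorem Schoen1998_weilClasses_algebraic_of_prod_surface_all_of_exists_section_algebraicTwist_weilSurfaces
    (h : ∀ (A₂ : Motives.AbelianVariety ℂ) (φ₂ : A₂ ⟶ A₂) (d : ℕ), 0 < d → A₂.dim = 2 * 1 →
      ∀ (hA₂ : Motives.IsSmoothProjective (2 * 1) A₂.X), φ₂ ≫ φ₂ = -(d • 𝟙 A₂) →
      letI : AlgebraicGeometry.IsIntegral A₂.X.left := Motives.IsSmoothProjective.isIntegral_holds hA₂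
      ∀ (A : HodgeModel (2 * 1) A₂.X) (ι : Type) (L : HolomorphicLineBundle ι A.model A.carrier),
        ∃ (D : CartierDivisor A₂.X.left) (s : A₂.X.left.functionField) (_ : D.IsSection s), s ≠ 0 ∧
          ∃ σ : (L.tensor (cartierDivisorLineBundle A.isAnalytification D)).GlobalSection,
            σ.zeroSet ≠ Set.univ) :
    Schoen1998_weilClasses_algebraic_of_prod_surface_all :=
  Schoen1998_weilClasses_algebraic_of_prod_surface_all_of_surfaceWeilClasses_algebraic
    fun A₂ φ₂ d hd hdim hA hφ up um _ _ hr hw =>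
      mem_algebraicClasses_one_of_exists_section_algebraicTwist_hodgeModels hA
        (h A₂ φ₂ d hd hdim hA hφ) (up + um) hr hw

/-- **`Schoen1998_weilClasses_algebraic_of_prod_surface_all` from the surface-only named fact
`serre_theoremA_lineCocycle_surface`** (Serre, GAGA n° 16 Théorème A for the sheaf of sections of a
holomorphic line cocycle on a smooth projective SURFACE, sections form; `SerreTheoremALineBundles`):
Lefschetz `(1,1)` for surfaces follows from it variety by variety
(`lefschetzOneOne_surface_of_serre_theoremA`), and `…_of_lefschetzOneOne_surface` concludes — the
weakest named statement of the tree from which the partner-free road closes (the fact itself is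
discharged from the descent partner carried by its witness, `…_all_holds`).
[cite: Schoen1998HodgeWeilAddendum, §10 (Proposition and proof, pp. 332–333)]
[cite: SerreGAGA1956, n° 16–17 Théorèmes A–B] [cite: VoisinHodgeI2002, Thm. 11.30, Cor. 11.34 and §11.3.2] -/
theorem Schoen1998_weilClasses_algebraic_of_prod_surface_all_of_serre_theoremA_surface
    (hA : serre_theoremA_lineCocycle_surface) :
    Schoen1998_weilClasses_algebraic_of_prod_surface_all :=
  Schoen1998_weilClasses_algebraic_of_prod_surface_all_of_lefschetzOneOne_surface
    (lefschetzOneOne_surface_of_serre_theoremA hA)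

/-- **`Schoen1998_weilClasses_algebraic_of_prod_surface_all` from the all-dimensional Kodaira–Serre
named fact `kodairaSerre_exists_globalSection_algebraicTwist`** (`KodairaSerreSections`; Voisin I,
proof of Cor. 11.34 via Thm. 7.11), through its `n = 2` slice
(`serre_theoremA_lineCocycle_surface_of_kodairaSerre`, file `LefschetzOneOneOfKodairaSerre`).
[cite: Schoen1998HodgeWeilAddendum, §10 (Proposition and proof, pp. 332–333)]
[cite: VoisinHodgeI2002, Cor. 11.34 (proof) and Thm. 7.11] -/
theorem Schoen1998_weilClasses_algebraic_of_prod_surface_all_of_kodairaSerre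
    (hKS : kodairaSerre_exists_globalSection_algebraicTwist) :
    Schoen1998_weilClasses_algebraic_of_prod_surface_all :=
  Schoen1998_weilClasses_algebraic_of_prod_surface_all_of_serre_theoremA_surface
    (serre_theoremA_lineCocycle_surface_of_kodairaSerre hKS)

/-- **`Schoen1998_weilClasses_algebraic_of_prod_surface_all` from GAGA for line bundles**
(`serreGAGA_lineCocycle_iso_cartierDivisorCocycle`, `GAGALineBundles`; Serre 1956 n° 20 Prop. 18),
through `lefschetzOneOne_rational_of_serreGAGA` (`LefschetzOneOneOfGAGA`) and `…_of_lefschetzOneOne`.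
[cite: Schoen1998HodgeWeilAddendum, §10 (Proposition and proof, pp. 332–333)]
[cite: SerreGAGA1956, n° 20 Prop. 18] -/
theorem Schoen1998_weilClasses_algebraic_of_prod_surface_all_of_serreGAGA
    (hG : serreGAGA_lineCocycle_iso_cartierDivisorCocycle) :
    Schoen1998_weilClasses_algebraic_of_prod_surface_all :=
  Schoen1998_weilClasses_algebraic_of_prod_surface_all_of_lefschetzOneOne
    (lefschetzOneOne_rational_of_serreGAGA hG)

end Literature.AlgebraicGeometry.HodgeTheory

end
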